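import Literature.IUT.LogVolume.Corollary22PartII
import HarnessLib

/-!
# [IUTchIV] Corollary 2.2 (ii) IN BOUNDED DEGREE: the `d ≤ d₀` clauses of (ii) from Theorem 1.10's display at
# points of degree `≤ d₀` only

Mochizuki, *Inter-universal Teichmüller theory IV*, RIMS manuscript (Apr. 2020; = PRIMS **57** (2021)), Cor. 2.2
(ii), statement pp. 41–43 ("Let `d` be a positive integer …"), proof pp. 43–48 (Thm. 1.10 applied on p. 46 l. 1).

The proof of Cor. 2.2 (ii) is POINTWISE IN THE DEGREE: the clause of (ii) for a given `d` consumes Theorem 1.10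
only at points `x_E ∈ K_V ∩ U_X(ℚ̄)^{≤d}` (abc-iut-S3's `Cor22.partII_of_thm110Legendre`, whose only use of the
interface `Cor22.Thm110Legendre` is at the point under consideration). This file records that bookkeeping as a
DEGREE-BOUNDED twin of the two statements, so that the cell can state what the IUT chain yields for points of
BOUNDED degree — in particular for `d₀ = 1` (points `λ ∈ ℚ`, field of moduli `F_mod = ℚ`, `d_mod = 1`), where
[IUTchIV] Thm. 1.10 Step (v)'s tensor-packet collections are slot-constant (one place of `F_mod` over each `p`;
cf. the cell's note plan/c312/STEPV-IND1-NOTE.md) and the (Ind1) symmetrisation question does not arise: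

* `Cor22.Thm110LegendreUpTo d₀` — the display of Thm. 1.10 as applied on p. 46 (`Cor22.Display`), for the points
  of `U_X` of degree `≤ d₀` only (same binders as `Cor22.Thm110Legendre`, plus `P.degree ≤ d₀`); CLAIM form, a
  HYPOTHESIS resting on [IUTchIII] Cor. 3.12, never asserted; `Thm110Legendre → Thm110LegendreUpTo d₀`;
* `Cor22.PartIIUpTo D H_unif d₀` — Cor. 2.2 (ii) for `K_V = D` with its degree clauses restricted to `1 ≤ d ≤ d₀`
  (verbatim otherwise); `PartII D H → PartIIUpTo D H d₀`;
* **`Cor22.partIIUpTo_of_thm110LegendreUpTo`** — `Thm110LegendreUpTo d₀ → FullGaloisImage → IsEtaPrm η →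
  Hypotheses D → PartIIUpTo D 2^140 d₀`: abc-iut-S3's proof of `partII_of_thm110Legendre` VERBATIM with the one
  extra binder threaded (the universal constants `H_unif = 2^140`, `C_K`, `H_K` unchanged);
  `exists_partIIUpTo_of_thm110LegendreUpTo` (uniform `H_II`, `FullGaloisImage` discharged by
  `Cor22.fullGaloisImage_holds`).

TAKES NO SIDE on [IUTchIII] Cor. 3.12 (it enters only through the hypothesis `Thm110LegendreUpTo`, by name).
Companion of `Corollary22PartII.lean` (abc-iut-S3); written by abc-iut-S2 for the cell's bounded-degree reading.
-/

noncomputable section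

namespace Literature.IUT.LogVolume

namespace Cor22

open NumberField IsDedekindDomain Real Polynomial Finset
open Literature.NumberTheory.DiophantineGeometry.GenEll

/-! ## The degree-bounded statements -/

/-- **What the proof of Cor. 2.2 (ii) takes from Theorem 1.10, at points of degree `≤ d₀` only**: the display
`(1/6)·log(q) ≤ (1 + 20·d_mod/l)·(log(𝔡^{F_tpd}) + log(𝔣^{F_tpd})) + 20·(d*_mod·l + η_prm)` (p. 46 l. 1) for every
`η_prm` of Prop. 1.6, every `λ ∈ U_X` presented minimally with `[F_tpd : ℚ] ≤ d₀`, every prime `l ≥ 5` with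
`AdmitsCore`, (P2), (P5), (P6) — the binders of `Cor22.Thm110Legendre` plus the degree bound. HYPOTHESIS (rests on
[IUTchIII] Cor. 3.12); never asserted. [claim: Mochizuki2012, status: disputed] -/
@[claim "Mochizuki2012" "disputed"]
def Thm110LegendreUpTo (d₀ : ℕ) : Prop :=
  ∀ η : ℝ, IsEtaPrm η → ∀ P : NFPoint, P ∈ UP → P.degree ≤ d₀ → ∀ l : ℕ, l.Prime → 5 ≤ l →
    AdmitsCore P → CondP2 P l → CondP5 P l → CondP6 P l → Display P l η

/-- The unrestricted interface implies every degree-bounded one. [claim: Mochizuki2012, status: disputed] -/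
theorem thm110LegendreUpTo_of_thm110Legendre (h : Thm110Legendre) (d₀ : ℕ) : Thm110LegendreUpTo d₀ :=
  fun η hη P hP _ l hl h5 hc h2 h5' h6 => h η hη P hP l hl h5 hc h2 h5' h6

/-- Monotonicity in the degree bound. [claim: Mochizuki2012, status: disputed] -/
theorem thm110LegendreUpTo_mono {d₀ d₁ : ℕ} (hd : d₀ ≤ d₁) (h : Thm110LegendreUpTo d₁) :
    Thm110LegendreUpTo d₀ :=
  fun η hη P hP hdeg l hl h5 hc h2 h5' h6 => h η hη P hP (hdeg.trans hd) l hl h5 hc h2 h5' h6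

/-- **Cor. 2.2 (ii) for `K_V = D` with its degree clauses restricted to `1 ≤ d ≤ d₀`** (pp. 41–43: "there exist
… `C_K` and `H_K` … such that …: Let `d` be a positive integer [here: `≤ d₀`], `ε_d` a positive real number `≤ 1`.
Then there exists a finite subset `Exc_d` … (C1) … (C2) …"), verbatim the body of `Cor22.PartII` otherwise.
[claim: Mochizuki2012, status: disputed] -/
@[claim "Mochizuki2012" "disputed"]
def PartIIUpTo (D : CBData) (Hunif : ℝ) (d₀ : ℕ) : Prop :=
  ∃ CK HK : ℝ, 0 < CK ∧ 0 < HK ∧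
    ∀ d : ℕ, 1 ≤ d → d ≤ d₀ → ∀ εd : ℝ, 0 < εd → εd ≤ 1 →
      ∃ Exc : Set NFPoint, HasFinitelyManyPoints Exc ∧ Exc ⊆ UPle d ∧
        (∀ P ∈ D.toSet ∩ UPle d, (jInv P.x = 0 ∨ jInv P.x = 1728) → P ∈ Exc) ∧
        (∀ P ∈ Exc, logQForall P ≤ Hunif * εd ^ (-(3 : ℝ)) * (d : ℝ) ^ (4 + εd) + HK) ∧
        ∀ P ∈ D.toSet ∩ UPle d, P ∉ Exc →
          ∃ l : ℕ, l.Prime ∧ 5 ≤ l ∧ ConditionsC1C2 d CK P l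

/-- Part (ii) implies every degree-bounded form. [claim: Mochizuki2012, status: disputed] -/
theorem partIIUpTo_of_partII {D : CBData} {Hunif : ℝ} (h : PartII D Hunif) (d₀ : ℕ) : PartIIUpTo D Hunif d₀ := by
  obtain ⟨CK, HK, hCK, hHK, h⟩ := h
  exact ⟨CK, HK, hCK, hHK, fun d hd _ εd hεd0 hεd1 => h d hd εd hεd0 hεd1⟩

/-- Monotonicity of the degree-bounded form in the bound. [claim: Mochizuki2012, status: disputed] -/
theorem partIIUpTo_mono {D : CBData} {Hunif : ℝ} {d₀ d₁ : ℕ} (hd : d₀ ≤ d₁) (h : PartIIUpTo D Hunif d₁) :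
    PartIIUpTo D Hunif d₀ := by
  obtain ⟨CK, HK, hCK, hHK, h⟩ := h
  exact ⟨CK, HK, hCK, hHK, fun d hd' hdd εd hεd0 hεd1 => h d hd' (hdd.trans hd) εd hεd0 hεd1⟩


/-- At a DEGREE-ONE point (`λ ∈ ℚ`), `d_mod = 1`: `F_mod = ℚ(j(λ)) = ℚ` — the slot-constant case of [IUTchIV]
Thm. 1.10 Step (v) (one place of `F_mod` over each rational prime). [cite: Mochizuki2012, IUTchIV Thm. 1.10 p.22] -/
theorem dmod_eq_one_of_degree_le_one {P : NFPoint} (h : P.degree ≤ 1) : dmod P = 1 :=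
  le_antisymm ((dmod_le_degree P).trans h) (dmod_pos P)

/-! ## Real arithmetic of the exclusions (abc-iut-S3's private helpers, re-proved privately here) -/

/-- `ε_d^{−3} ≥ 1` for `0 < ε_d ≤ 1`. [folklore] -/
private theorem one_le_rpow_neg_three {ε : ℝ} (hε0 : 0 < ε) (hε1 : ε ≤ 1) : 1 ≤ ε ^ (-(3 : ℝ)) := by
  rw [Real.rpow_neg hε0.le]
  exact (one_le_inv₀ (Real.rpow_pos_of_pos hε0 _)).mpr (Real.rpow_le_one hε0.le hε1 (by norm_num))

/-- `d² ≤ d^{4+ε_d}` for `d ≥ 1`, `ε_d > 0`. [folklore] -/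
private theorem natCast_sq_le_rpow {d : ℕ} (hd : 1 ≤ d) {ε : ℝ} (hε0 : 0 < ε) : (d : ℝ) ^ 2 ≤ (d : ℝ) ^ (4 + ε) := by
  have hd1 : (1 : ℝ) ≤ d := by exact_mod_cast hd
  calc (d : ℝ) ^ 2 = (d : ℝ) ^ ((2 : ℕ) : ℝ) := (Real.rpow_natCast _ 2).symm
    _ ≤ (d : ℝ) ^ (4 + ε) := Real.rpow_le_rpow_of_exponent_le hd1 (by push_cast; linarith)

/-- The (P5)-exclusion constant fits the printed shape: `81·δ² ≤ 2^45·ε_d^{−3}·d^{4+ε_d}`. [folklore] -/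
private theorem delta_sq_le_shape {d : ℕ} (hd : 1 ≤ d) {ε : ℝ} (hε0 : 0 < ε) (hε1 : ε ≤ 1) :
    81 * delta d ^ 2 ≤ 2 ^ 45 * (ε ^ (-(3 : ℝ)) * (d : ℝ) ^ (4 + ε)) := by
  unfold delta
  have h1 := one_le_rpow_neg_three hε0 hε1
  have h2 := natCast_sq_le_rpow hd hε0
  have hd0 : (0 : ℝ) ≤ (d : ℝ) ^ 2 := sq_nonneg _
  have h3 : 1 * (d : ℝ) ^ 2 ≤ ε ^ (-(3 : ℝ)) * (d : ℝ) ^ (4 + ε) :=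
    mul_le_mul h1 h2 hd0 (le_trans zero_le_one h1)
  calc 81 * (2 ^ 12 * 3 ^ 3 * 5 * (d : ℝ)) ^ 2 = (81 * 552960 ^ 2) * (1 * (d : ℝ) ^ 2) := by ring
    _ ≤ 2 ^ 45 * (1 * (d : ℝ) ^ 2) := by nlinarith
    _ ≤ 2 ^ 45 * (ε ^ (-(3 : ℝ)) * (d : ℝ) ^ (4 + ε)) := by nlinarith

/-! ## The assembly in bounded degree -/

/-- **[IUTchIV] Corollary 2.2 (ii) in degree `≤ d₀`, PROVED from `Thm110LegendreUpTo d₀` and `FullGaloisImage`**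
(with `H_unif := 2^140`): abc-iut-S3's proof of `Cor22.partII_of_thm110Legendre` (pp. 43–48, see that file's module
docstring) verbatim, the interface being consumed only at the point `x_E ∈ K_V ∩ U_X(ℚ̄)^{≤d}`, `d ≤ d₀`, under
consideration. The disputed Theorem 1.10 enters only through `h110`. [claim: Mochizuki2012, status: disputed] -/
theorem partIIUpTo_of_thm110LegendreUpTo {d₀ : ℕ} (h110 : Thm110LegendreUpTo d₀) (hFG : FullGaloisImage)
    {η : ℝ} (hη : IsEtaPrm η) (D : CBData) (hD : Hypotheses D) : PartIIUpTo D (2 ^ 140) d₀ := by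
  classical
  -- the constants delivered by Cor. 2.2 (i): `B_K` (p. 47) and the height comparison for Northcott
  obtain ⟨h12, h23, h3⟩ := partI_holds D hD
  obtain ⟨B₀, hB₀⟩ := bdEquiv_iff_abs.mp h12
  set B₁ : ℝ := max B₀ 0 with hB₁def
  have hB₁0 : 0 ≤ B₁ := le_max_right _ _
  have hB₁ : ∀ P ∈ D.toSet, |1 / 6 * logQNotTwo P - 1 / 6 * logQForall P| ≤ B₁ := fun P hP => by
    have hx : |1 / 6 * logQNotTwo P - 1 / 6 * logQForall P| ≤ B₀ := hB₀ P hP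
    exact hx.trans (le_max_left _ _)
  obtain ⟨C₀, hC₀⟩ := (h3.symm.trans h23.symm).bdLe
  -- the `H_K` of the classical Galois-image input (the (P4) step, pp. 45–46); `ξ_prm`; `η_prm > 0`
  obtain ⟨G₀, hG₀⟩ := hFG D hD
  set G : ℝ := max G₀ 0 with hGdef
  have hG0 : 0 ≤ G := le_max_right _ _
  obtain ⟨ξ, hξ⟩ := exists_isXiPrm
  have hξ5 : 5 ≤ ξ := hξ.1
  have hη0 : 0 < η := hη.1
  -- `C_K := 40·η_prm + 2·B_K`, `H_K`
  set HK : ℝ := ξ ^ 2 + 12 * B₁ + G + 13 with hHKdef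
  have hHK0 : 0 < HK := by positivity
  refine ⟨CK η B₁, HK, by unfold CK; positivity, hHK0, ?_⟩
  intro d hd hdd₀ εd hεd0 hεd1
  -- the exceptional set
  set X : ℝ := εd ^ (-(3 : ℝ)) * (d : ℝ) ^ (4 + εd) with hXdef
  have hX0 : 0 ≤ X := mul_nonneg (Real.rpow_nonneg hεd0.le _) (Real.rpow_nonneg (Nat.cast_nonneg _) _)
  set Bd : ℝ := 2 ^ 140 * X + HK with hBddef
  have hBd0 : 0 ≤ Bd := by positivity
  have hBdX : 0 ≤ 2 ^ 140 * X := by positivity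
  have hξ2 : (25 : ℝ) ≤ ξ ^ 2 := by nlinarith
  have hBd1 : ξ ^ 2 ≤ Bd := by linarith
  have hBd2 : G < Bd := by linarith
  have hBd3 : 12 * B₁ + 81 * delta d ^ 2 ≤ Bd := by
    have := delta_sq_le_shape hd hεd0 hεd1
    nlinarith
  have hBd4 : (16 / εd) ^ (3 : ℝ) * (60 * delta d) ^ (4 + εd) ≤ Bd := by
    have := epsE_exclusion_le_shape hd hεd0 hεd1
    nlinarith
  have hBd5 : 12 ≤ Bd := by linarith
  have hX1 : 1 ≤ X := by
    have h1 := one_le_rpow_neg_three hεd0 hεd1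
    have h2 : (1 : ℝ) ≤ (d : ℝ) ^ (4 + εd) :=
      Real.one_le_rpow (by exact_mod_cast hd) (by linarith)
    nlinarith
  have hBd6 : 49 < Bd := by nlinarith
  refine ⟨{P | P ∈ D.toSet ∩ UPle d ∧ logQForall P ≤ Bd}, ?_, ?_, ?_, ?_, ?_⟩
  · -- finiteness: Northcott ([GenEll] Prop. 1.4 (iv)) through (i) `ht ≤ (1/6)·log(q^∀) + C₀` on `K_V`
    refine (northcott_UPle_holds d (1 / 6 * Bd + C₀)).mono ?_
    rintro P ⟨⟨hPD, hPd⟩, hPB⟩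
    refine ⟨hPd, ?_⟩
    have hx : NFPoint.ht P - 1 / 6 * logQForall P ≤ C₀ := hC₀ P hPD
    linarith
  · rintro P ⟨⟨_, hPd⟩, _⟩; exact hPd
  · -- `j ∈ {0, 1728}`: `log(q^∀) = 0`
    rintro P hP hj
    exact ⟨hP, by rw [logQForall_eq_zero_of_jInv_zero_or_1728 hj]; exact hBd0⟩
  · rintro P ⟨_, hPB⟩
    show logQForall P ≤ 2 ^ 140 * εd ^ (-(3 : ℝ)) * (d : ℝ) ^ (4 + εd) + HK
    rw [mul_assoc]; exact hPB
  -- the main case: `x_E ∈ K_V ∩ U_X(ℚ̄)^{≤d}`, `x_E ∉ Exc_d`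
  rintro P ⟨hPD, hPd⟩ hPexc
  have hPU : P ∈ UP := hPd.1
  have hPdeg : P.degree ≤ d := hPd.2
  have hInU : P.InU := hPU.1
  set h : ℝ := logQForall P with hhdef
  have hgt : Bd < h := by
    by_contra hle
    exact hPexc ⟨⟨hPD, hPd⟩, not_lt.mp hle⟩
  have hh0 : 0 ≤ h := logQAvoid_nonneg P ∅
  set s : ℝ := Real.sqrt h with hsdef
  have hs2 : s ^ 2 = h := Real.sq_sqrt hh0
  have hξs : ξ ≤ s := by
    have h1 : Real.sqrt (ξ ^ 2) ≤ Real.sqrt h := Real.sqrt_le_sqrt (by linarith)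
    rwa [Real.sqrt_sq (by linarith)] at h1
  have h5s : 5 ≤ s := le_trans hξ5 hξs
  have hδ2 := two_le_delta hd
  have hδ := delta_ge hd
  have hdδ : (P.degree : ℝ) ≤ delta d := by
    have : (P.degree : ℝ) ≤ d := by exact_mod_cast hPdeg
    unfold delta; nlinarith
  -- the curves without `F`-core are in `Exc_d` (p. 43): `log(q^∀) ≤ 12 ≤ B_d` there
  have hcore : AdmitsCore P := by
    by_contra hno
    have := logQForall_le_of_not_admitsCore hno
    linarith
  -- the prime `l` of (P1), (P2), (P3) (pp. 44–45)
  have hprime : ∃ l : ℕ, l.Prime ∧ Real.sqrt h ≤ l ∧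
      (l : ℝ) ≤ 10 * delta d * Real.sqrt h * Real.log (2 * delta d * h) ∧
      (∀ v ∈ badPlaces P, (-(ord P.F v (jInv P.x))).toNat ≠ 0 → ¬ l ∣ (-(ord P.F v (jInv P.x))).toNat) ∧
      (∀ v ∈ badPlaces P, residueChar P.F v = l →
        (((-(ord P.F v (jInv P.x))).toNat : ℕ) : ℝ) < Real.sqrt h) :=
    PrimeChoiceData.exists_prime_P1_P2_P3
      { ι := HeightOneSpectrum (𝓞 P.F), instDecEq := inferInstance, V := badPlaces P,
        hv := fun v => (-(ord P.F v (jInv P.x))).toNat, fv := resDeg P.F,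
        one_le_fv := fun v _ => Nat.one_le_iff_ne_zero.mpr (resDeg_ne_zero P.F v),
        pv := residueChar P.F, pv_prime := fun v _ => residueChar_prime P.F v,
        d := P.degree, one_le_d := P.degree_pos, δ := delta d, two_le_δ := hδ2, d_le_δ := hdδ,
        h := h, h_def := degree_mul_logQForall_eq_sum P, ξ := ξ, isXiPrm := hξ, ξ_le_sqrt := hξs }
  obtain ⟨l, hlp, hP1lo, hP1hi, hP2, hP3⟩ := hprime
  haveI : Fact l.Prime := ⟨hlp⟩
  -- `l ≥ h^{1/2} > 7` (so `l ≥ 7`: both the `5 ≤ l` of [IUTchI] Def. 3.1 (c) and the `7 ≤ l` form of the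
  -- classical Galois-image input are available; `l ≠ 5` as on p. 22)
  have h7s : 7 < s := by
    rw [hsdef, Real.lt_sqrt (by norm_num)]
    linarith
  have h7l : 7 ≤ l := by
    have : (7 : ℝ) ≤ l := le_trans h7s.le hP1lo
    exact_mod_cast this
  have h5l : 5 ≤ l := le_trans (by norm_num) h7l
  have hl5 : (5 : ℝ) ≤ l := by exact_mod_cast h5l
  have hP2' : CondP2 P l := condP2_of_toNat hP2
  -- consequences of (P3) and (i) (p. 47): `log(q^{∤2}) − log(q) ≤ h^{1/2}·log(l)`, `h − log(q^{∤2}) ≤ 6·B_K`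
  have hQ1 : logQNotTwo P - logQAvoid P {2, l} ≤ s * Real.log l := by
    have := logQAvoid_sub_insert_le P {2} hlp (Real.sqrt_nonneg h) (fun v hv hlv =>
      (hP3 v hv ((mem_placesOver_iff_residueChar v).mp (mem_placesOver_of_natCast_mem l v hlv))).le)
    rwa [Finset.pair_comm] at this
  have hQ2 : h - logQNotTwo P ≤ 6 * B₁ := by
    have := (abs_le.mp (hB₁ P hPD)).1
    linarith
  have hq12 : logQAvoid P {2, l} ≤ logQNotTwo P :=
    logQAvoid_anti P (Finset.singleton_subset_iff.mpr (Finset.mem_insert_self 2 {l}))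
  have hq2h : logQNotTwo P ≤ h := logQAvoid_anti P (Finset.empty_subset _)
  -- (P5): `𝕍^bad_mod ≠ ∅` (else `h ≤ 12·B_K + 81·δ² ≤ B_d < h`)
  have hP5 : CondP5 P l := by
    by_contra hno
    have hq0 := logQAvoid_pair_eq_zero_of_not_condP5 hno
    have hL : (l : ℝ) ≤ 20 * delta d ^ 2 * s ^ 4 := l_le_of_P1 h5s hδ2 (by rw [hs2]; exact hP1hi)
    have hmain : s ^ 2 ≤ 6 * B₁ + s * Real.log l := by rw [hs2]; linarith
    have := h_le_of_no_bad h5s hδ hB₁0 hl5 hL hmain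
    rw [hs2] at this
    linarith
  -- (P4) ⇒ (P6): the classical Galois-image input (pp. 45–46), applicable since `h > H_K ≥ G₀`
  have hP6 : CondP6 P l := hG₀ P hPD hPU l hlp (by omega) hP2' hP5 (by linarith [le_max_left G₀ 0])
  -- (P7) + Theorem 1.10 (p. 46): the HYPOTHESIS
  have hdisp : Display P l η := h110 η hη P hPU (hPdeg.trans hdd₀) l hlp (by omega) hcore hP2' hP5 hP6
  -- the arithmetic pp. 46–48 (`Corollary22Arithmetic.lean`), with `d*_mod` in the rôle of `e*_mod`
  let A : Data :=
    { s := s, five_le_s := h5s, δ := delta d, two_le_δ := hδ2, l := l, P1lo := hP1lo,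
      P1hi := by rw [hs2]; exact hP1hi,
      L := P.logDiff + logCondAvoid P {2, l},
      L_nonneg := add_nonneg P.logDiff_nonneg (logCondAvoid_nonneg P _),
      η := η, η_nonneg := hη0.le, B := B₁, B_nonneg := hB₁0,
      logq := logQAvoid P {2, l}, logq2 := logQNotTwo P,
      dmod := dmod P, dmod_nonneg := Nat.cast_nonneg _, twenty_dmod_le := twenty_dmod_le P hPdeg,
      estar := 2 ^ 12 * 3 ^ 3 * 5 * (dmod P : ℝ), estar_nonneg := by positivity,
      estar_le := dstar_le_delta P hPdeg,
      disp := hdisp,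
      Q1 := by linarith,
      Q2 := by rw [hs2]; linarith }
  by_cases hε : epsE (delta d) s ≤ 1
  · have hC2 : 1 / 6 * logQAvoid P {2, l} ≤ 1 / 6 * logQNotTwo P ∧ 1 / 6 * logQNotTwo P ≤ 1 / 6 * s ^ 2 ∧
        1 / 6 * s ^ 2 ≤ (1 + epsE (delta d) s) * (P.logDiff + P.logCond) + CK η B₁ :=
      A.condition_C2 hε (logDiffTpd := P.logDiff) (logCondTpd := logCondAvoid P {2, l}) rfl rfl
        (logCondAvoid_le_logCond P hInU _) hq12 (by rw [hs2]; exact hq2h)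
    obtain ⟨c1, c2, c3⟩ := hC2
    have heps : epsilonE d P = epsE (delta d) s := by
      unfold epsilonE epsE
      rw [← hhdef, ← hsdef, hs2]
      ring
    refine ⟨l, hlp, h5l, hP1lo, hP1hi, c1, ?_, ?_⟩
    · rw [hs2] at c2; exact c2
    · rw [heps, ← hhdef, ← hs2]; exact c3
  · -- `ε_E > 1`: excluded (p. 47), `h < (16/ε_d)³·(60δ)^{4+ε_d} ≤ B_d < h`
    exfalso
    rw [not_le] at hε
    have hlt : s ^ 2 < (16 / εd) ^ (3 : ℝ) * (60 * delta d) ^ (4 + εd) := A.h_lt_of_one_lt_epsE hε hεd0 hεd1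
    rw [hs2] at hlt
    linarith

/-- **Cor. 2.2 (ii) in bounded degree, uniform form**: from `Thm110LegendreUpTo d₀` and the PROVED classical
Galois-image input, `∃ H_II, ∀ K_V (hypotheses of Cor. 2.2), PartIIUpTo K_V H_II d₀`.
[claim: Mochizuki2012, status: disputed] -/
theorem exists_partIIUpTo_of_thm110LegendreUpTo {d₀ : ℕ} (h110 : Thm110LegendreUpTo d₀) (hFG : FullGaloisImage) :
    ∃ HII : ℝ, ∀ D : CBData, Hypotheses D → PartIIUpTo D HII d₀ := by
  obtain ⟨η, hη⟩ := exists_isEtaPrm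
  exact ⟨2 ^ 140, fun D hD => partIIUpTo_of_thm110LegendreUpTo h110 hFG hη D hD⟩

end Cor22

end Literature.IUT.LogVolume

end
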